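import Summits.HodgeConjecture.CorCM.IrreducibleOddWeightsShadowModulesCriteria
import Summits.HodgeConjecture.CorCM.IrreducibleOddWeightsShadowModulesOneSidedCMFields
import HarnessLib

/-!
# Shadow modules, IX (CM fields): the HODGE SIDE of absorption — an equivariant map carrying shadow to shadow, or an
# absorbed shadow module, produces EXCEPTIONAL (non-product) Hodge classes on some `A₀^a × A₁^b`

COR-CM (cell `pub-hodgecm2`, binder seat `b16` gen 69, count-neutral claim ROW SPACES OVER THE COMMUTANT, file Q10 — CM
fields; theorems only, no definition, no named fact, no `sorry`).  NEW as stated, hence under `Summits/`.  HONEST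
FRAMING: files Q4/Q7b (interaction criteria over (IRR) pivots) combined with the tree's Moonen–Zarhin converse
(`exists_not_hodgeClassesProductSpan_of_cmFamilyRank_add_card_ne`: a non-additive family of realisations carries, on some
product with disjoint slot maps, a rational Hodge class that is NOT a combination of exterior products).  Nothing is claimed
about the algebraicity of these classes; `HC_CM` is neither used nor asserted.

* **`exists_not_hodgeClassesProductSpan_of_map`** — (IRR) CM pivots `T₀ ⊆ K_{i₀}`, `T₁ ⊆ K_{i₁}` ⊇ traces; an
  `Aut(ℂ)`-equivariant `L : ℚ^{Hom(T₁,ℂ)} → ℚ^{Hom(T₀,ℂ)}`, injective on `Anti(T₁)` into `Anti(T₀)`, carrying the shadow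
  `w₁` of `Φ₁` to the NON-ZERO shadow `w₀` of `Φ₀` ⟹ for every family of realisations `A_i ⊨ (K_i; Φ_i)` some
  `(⨁_j A_{π₁ j}) × (⨁_j A_{π₂ j})` (disjoint slot maps) carries an exceptional Hodge class.
* **`exists_not_hodgeClassesProductSpan_of_le`** — one-sided: `T₀` (IRR), partner arbitrary, `w₀ ≠ 0` and `S(w₀) ≤ MC₁`
  (absorption) ⟹ the same conclusion.

## References

* [MoonenZarhin1999LowDim] B. Moonen, Yu. Zarhin, *Hodge classes on abelian varieties of low dimension*, §3 (3.1).
* [Gordon1999HodgeAVSurvey] B. B. Gordon, *A survey of the Hodge conjecture for abelian varieties*, §3 Theorem, 7.5–7.7.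
-/

set_option autoImplicit false

noncomputable section

open scoped BigOperators Classical

open CategoryTheory CategoryTheory.Limits NumberField Module IntermediateField

namespace Summit.HodgeConjecture.CorCM

open Literature.NumberTheory.ComplexMultiplication
open Literature.AlgebraicGeometry.Motives (AbelianVariety CMType)
open Literature.AlgebraicGeometry.Motives.AbelianVariety
open Literature.AlgebraicGeometry.HodgeTheory
open Literature.AlgebraicGeometry.ComplexMultiplication (IsCMTypeRealisation)
open Literature.AlgebraicGeometry.Pohlmann1968

variable {I : Type} [Fintype I] {K : I → Type} [∀ i, Field (K i)] [∀ i, NumberField (K i)]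
  [∀ i, IsCMField (K i)] {Φ : ∀ i, CMType (K i)} {A : I → AbelianVariety ℂ} {ιA : ∀ i, 𝓞 (K i) →+* End (A i)}
  {θ : ∀ i, K i →+* Module.End ℂ (complexBetti (A i).X 1)}
  {T₀ : Type} [Field T₀] [NumberField T₀] [IsCMField T₀] {T₁ : Type} [Field T₁] [NumberField T₁] [IsCMField T₁]

omit [∀ i, NumberField (K i)] [∀ i, IsCMField (K i)] in
/-- Pair form to family form: `cmTypeRank Φ₀ + cmTypeRank Φ₁ ≠ cmFamilyRank Φ + 1` ⟹ the family `Φ` on `I = {i₀, i₁}` is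
not additive. [cite: Gordon1999HodgeAVSurvey, 7.5–7.7] -/
theorem cmFamilyRank_add_card_ne_of_pair_ne {i₀ i₁ : I} (h01 : i₀ ≠ i₁) (hI : ∀ l, l = i₀ ∨ l = i₁)
    (Φ : ∀ i, CMType (K i)) (hne : cmTypeRank (Φ i₀) + cmTypeRank (Φ i₁) ≠ CMAlgebra.cmFamilyRank Φ + 1) :
    CMAlgebra.cmFamilyRank Φ + Fintype.card I ≠ (∑ i, cmTypeRank (Φ i)) + 1 := by
  have hcard : Fintype.card I = 2 := by
    rw [← Finset.card_univ, show (Finset.univ : Finset I) = {i₀, i₁} from Finset.ext fun j => by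
      simpa only [Finset.mem_univ, Finset.mem_insert, Finset.mem_singleton, true_iff] using hI j,
      Finset.card_pair h01]
  rw [IrrOdd.sum_eq_add_of_pair _ hI h01, hcard]
  omega

/-- **AN EQUIVARIANT SHADOW-TO-SHADOW MAP PRODUCES EXCEPTIONAL HODGE CLASSES.**  (IRR) CM pivots `T₀ ⊆ K_{i₀}`,
`T₁ ⊆ K_{i₁}` containing the traces; an `Aut(ℂ)`-equivariant `ℚ`-linear `L`, injective on `Anti(T₁)` with values in
`Anti(T₀)`, carrying the shadow of `Φ_{i₁}` to the NON-ZERO shadow of `Φ_{i₀}`; realisations `A_i ⊨ (K_i; Φ_i)`.  Then some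
product `(⨁_j A_{π₁ j}) × (⨁_j A_{π₂ j})` with disjoint slot maps carries a rational Hodge class that is NOT a
`ℂ`-combination of exterior products of Hodge classes of the factors.
[cite: MoonenZarhin1999LowDim, §3 (3.1)] [cite: Gordon1999HodgeAVSurvey, §3 Theorem, 7.5–7.7] -/
theorem exists_not_hodgeClassesProductSpan_of_map {i₀ i₁ : I} (h01 : i₀ ≠ i₁) (hI : ∀ l, l = i₀ ∨ l = i₁)
    [Algebra T₀ (K i₀)] [Algebra T₁ (K i₁)]
    (htr₀ : ∀ (a : K i₀ →+* ℂ) (k : K i₀), a k ∈ normalClosure ℚ (K i₁) ℂ → k ∈ Set.range (algebraMap T₀ (K i₀)))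
    (htr₁ : ∀ (b : K i₁ →+* ℂ) (k : K i₁), b k ∈ normalClosure ℚ (K i₀) ℂ → k ∈ Set.range (algebraMap T₁ (K i₁)))
    (hirr₀ : ∀ W : Submodule ℚ ((T₀ →+* ℂ) → ℚ), W ≤ antiWeights (E := T₀ →+* ℂ) (starRingAut : ℂ ≃+* ℂ) → W ≠ ⊥ →
      (∀ (k : ℂ ≃+* ℂ) (f : (T₀ →+* ℂ) → ℚ), f ∈ W → (fun y => f (k • y)) ∈ W) →
        W = antiWeights (E := T₀ →+* ℂ) (starRingAut : ℂ ≃+* ℂ))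
    (hirr₁ : ∀ W : Submodule ℚ ((T₁ →+* ℂ) → ℚ), W ≤ antiWeights (E := T₁ →+* ℂ) (starRingAut : ℂ ≃+* ℂ) → W ≠ ⊥ →
      (∀ (k : ℂ ≃+* ℂ) (f : (T₁ →+* ℂ) → ℚ), f ∈ W → (fun y => f (k • y)) ∈ W) →
        W = antiWeights (E := T₁ →+* ℂ) (starRingAut : ℂ ≃+* ℂ))
    (hw₀ : (fun y : T₀ →+* ℂ => ∑ t ∈ Finset.univ.filter (fun t : K i₀ →+* ℂ => t.comp (algebraMap T₀ (K i₀)) = y),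
      antiVec (Φ i₀).1 (1 : ℂ ≃+* ℂ) t) ≠ 0)
    (L : ((T₁ →+* ℂ) → ℚ) →ₗ[ℚ] ((T₀ →+* ℂ) → ℚ))
    (hLA : ∀ f ∈ antiWeights (E := T₁ →+* ℂ) (starRingAut : ℂ ≃+* ℂ),
      L f ∈ antiWeights (E := T₀ →+* ℂ) (starRingAut : ℂ ≃+* ℂ))
    (hLinj : ∀ f ∈ antiWeights (E := T₁ →+* ℂ) (starRingAut : ℂ ≃+* ℂ), L f = 0 → f = 0)
    (hLeq : ∀ (k : ℂ ≃+* ℂ) (f : (T₁ →+* ℂ) → ℚ), f ∈ antiWeights (E := T₁ →+* ℂ) (starRingAut : ℂ ≃+* ℂ) →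
      L (fun y => f (k • y)) = fun y => L f (k • y))
    (hLw : L (fun y : T₁ →+* ℂ => ∑ t ∈ Finset.univ.filter (fun t : K i₁ →+* ℂ => t.comp (algebraMap T₁ (K i₁)) = y),
        antiVec (Φ i₁).1 (1 : ℂ ≃+* ℂ) t) =
      fun y : T₀ →+* ℂ => ∑ t ∈ Finset.univ.filter (fun t : K i₀ →+* ℂ => t.comp (algebraMap T₀ (K i₀)) = y),
        antiVec (Φ i₀).1 (1 : ℂ ≃+* ℂ) t)
    (hA : ∀ i, IsCMTypeRealisation (Φ i) (A i) (ιA i) (θ i)) :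
    ∃ (N₁ N₂ : ℕ) (_ : NeZero N₁) (_ : NeZero N₂) (π₁ : Fin N₁ → I) (π₂ : Fin N₂ → I),
      (∀ j₁ j₂, π₁ j₁ ≠ π₂ j₂) ∧ ¬ HodgeClassesProductSpan (⨁ fun j => A (π₁ j)) (⨁ fun j => A (π₂ j)) := by
  haveI : Nonempty I := ⟨i₀⟩
  refine exists_not_hodgeClassesProductSpan_of_cmFamilyRank_add_card_ne hA
    (cmFamilyRank_add_card_ne_of_pair_ne h01 hI Φ ?_)
  exact (cmTypeRank_add_cmTypeRank_ne_iff_of_irreducible h01 hI Φ htr₀ htr₁ hirr₀ hirr₁).2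
    ⟨hw₀, L, hLA, hLinj, hLeq, hLw⟩

omit [NumberField T₁] [IsCMField T₁] in
/-- **ABSORPTION PRODUCES EXCEPTIONAL HODGE CLASSES (one-sided).**  `T₀ ⊆ K_{i₀}` an (IRR) CM pivot containing the trace
of the ARBITRARY partner `K_{i₁}`; a type `Φ_{i₀}` with non-zero shadow `w₀` whose shadow-coefficient space is absorbed,
`S(w₀) ≤ MC₁`; realisations `A_i ⊨ (K_i; Φ_i)` ⟹ some product with disjoint slot maps carries an exceptional Hodge class.
[cite: MoonenZarhin1999LowDim, §3 (3.1)] [cite: Gordon1999HodgeAVSurvey, §3 Theorem, 7.5–7.7] -/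
theorem exists_not_hodgeClassesProductSpan_of_le {i₀ i₁ : I} (h01 : i₀ ≠ i₁) (hI : ∀ l, l = i₀ ∨ l = i₁)
    [Algebra T₀ (K i₀)]
    (htr₀ : ∀ (a : K i₀ →+* ℂ) (k : K i₀), a k ∈ normalClosure ℚ (K i₁) ℂ → k ∈ Set.range (algebraMap T₀ (K i₀)))
    (hirr₀ : ∀ W : Submodule ℚ ((T₀ →+* ℂ) → ℚ), W ≤ antiWeights (E := T₀ →+* ℂ) (starRingAut : ℂ ≃+* ℂ) → W ≠ ⊥ →
      (∀ (k : ℂ ≃+* ℂ) (f : (T₀ →+* ℂ) → ℚ), f ∈ W → (fun y => f (k • y)) ∈ W) →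
        W = antiWeights (E := T₀ →+* ℂ) (starRingAut : ℂ ≃+* ℂ))
    (hw₀ : (fun y : T₀ →+* ℂ => ∑ t ∈ Finset.univ.filter (fun t : K i₀ →+* ℂ => t.comp (algebraMap T₀ (K i₀)) = y),
      antiVec (Φ i₀).1 (1 : ℂ ≃+* ℂ) t) ≠ 0)
    (hle : Submodule.span ℚ (Set.range fun y : T₀ →+* ℂ => fun g : ℂ ≃+* ℂ =>
          ∑ t ∈ Finset.univ.filter (fun t : K i₀ →+* ℂ => t.comp (algebraMap T₀ (K i₀)) = g • y),
            antiVec (Φ i₀).1 (1 : ℂ ≃+* ℂ) t) ≤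
        Submodule.span ℚ (Set.range fun x : K i₁ →+* ℂ => fun g : ℂ ≃+* ℂ => antiVec (Φ i₁).1 g x))
    (hA : ∀ i, IsCMTypeRealisation (Φ i) (A i) (ιA i) (θ i)) :
    ∃ (N₁ N₂ : ℕ) (_ : NeZero N₁) (_ : NeZero N₂) (π₁ : Fin N₁ → I) (π₂ : Fin N₂ → I),
      (∀ j₁ j₂, π₁ j₁ ≠ π₂ j₂) ∧ ¬ HodgeClassesProductSpan (⨁ fun j => A (π₁ j)) (⨁ fun j => A (π₂ j)) := by
  haveI : Nonempty I := ⟨i₀⟩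
  refine exists_not_hodgeClassesProductSpan_of_cmFamilyRank_add_card_ne hA
    (cmFamilyRank_add_card_ne_of_pair_ne h01 hI Φ ?_)
  exact (cmTypeRank_add_cmTypeRank_ne_iff_le_of_irreducible_left h01 hI Φ htr₀ hirr₀ hw₀).2 hle

end Summit.HodgeConjecture.CorCM

end
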